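import Literature.Dynamics.NBody.JensenLeykin2025Dictionary
import Mathlib.Tactic
import HarnessLib

/-!
# Transfer: finiteness of the Jensen–Leykin torus system ⇒ finitely many mutual-distance vectors
# of positive planar central configurations (Albouy–Kaloshin Definition 1)

Every positive normalized central configuration `q` ([AlbouyKaloshin2012, Definition 1]; tree
`IsPositiveNormalizedCC m q`) is a real normalized central configuration of system (4) with the
POSITIVE choice `δ_kl = r_kl⁻¹` (`isRealNormalizedCC_of_isPositiveNormalizedCC`); composing with the
dictionary `JensenLeykin2025Dictionary.lean` gives: if the torus system of [JensenLeykin2025] is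
finite at the masses `m` (any `n`, `κ³ Σ m = 1`), then the set of rescaled mutual-distance vectors
`(κ r_kl)_{k,l}` of all positive normalized central configurations at `m` is finite
(`positiveCC_distanceData_finite_of_jlFinite`) — i.e. finiteness "up to isometry", the classical
formulation of Smale's 6th problem, follows at `m` from a torus certificate at `m`;
rev. 2 adds the unscaled form `positiveCC_distanceMatrix_finite_of_jlFinite` and the corollary of
the paper's named fact, `generic_distanceMatrix_finite_of_jlGenericFiniteness` /
`fiveBody_generic_distanceMatrix_finite` (generic finiteness up to isometry for positive masses).
-/

namespace Literature.Dynamics.NBody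

open Finset

/-- `sqDist` is symmetric. [folklore] -/
theorem sqDist_comm (p q : ℝ × ℝ) : sqDist p q = sqDist q p := by
  unfold sqDist; ring

/-- Distinct planar points have positive squared distance. [folklore] -/
theorem sqDist_pos_of_ne {p q : ℝ × ℝ} (h : p ≠ q) : 0 < sqDist p q := by
  unfold sqDist
  rcases lt_trichotomy ((q.1 - p.1) ^ 2 + (q.2 - p.2) ^ 2) 0 with hlt | heq | hgt
  · nlinarith [sq_nonneg (q.1 - p.1), sq_nonneg (q.2 - p.2)]
  · exfalso; apply h
    have h1 : q.1 - p.1 = 0 := by nlinarith [sq_nonneg (q.1 - p.1), sq_nonneg (q.2 - p.2)]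
    have h2 : q.2 - p.2 = 0 := by nlinarith [sq_nonneg (q.1 - p.1), sq_nonneg (q.2 - p.2)]
    exact Prod.ext (by linarith) (by linarith)
  · exact hgt

/-- The positive inverse distances of a configuration with pairwise distinct points. [folklore] -/
noncomputable def deltaOfPos {n : ℕ} (q : Fin n → ℝ × ℝ) : Fin n → Fin n → ℝ :=
  fun k l => if k = l then 0 else 1 / Real.sqrt (sqDist (q k) (q l))

/-- EMBEDDING: a positive normalized central configuration (Definition 1, system (1)) is a real
normalized central configuration of system (4) with `δ_kl = + r_kl⁻¹`.
[cite: AlbouyKaloshin2012, Definition 1 p. 536 and Definition 2 / (4) p. 540 — derived in-tree] -/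
theorem isRealNormalizedCC_of_isPositiveNormalizedCC {n : ℕ} {m : Fin n → ℝ} {q : Fin n → ℝ × ℝ}
    (h : IsPositiveNormalizedCC m q) : IsRealNormalizedCC m q (deltaOfPos q) := by
  obtain ⟨hdist, hforce, hnorm⟩ := h
  refine ⟨?_, ?_, ?_, hnorm⟩
  · intro k l
    by_cases hkl : k = l
    · subst hkl; rfl
    · simp only [deltaOfPos, hkl, Ne.symm hkl, if_false, sqDist_comm (q k) (q l)]
  · intro k l hkl
    have hpos := sqDist_pos_of_ne (hdist k l hkl)
    simp only [deltaOfPos, hkl, if_false]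
    rw [div_pow, one_pow, Real.sq_sqrt hpos.le]
    field_simp
  · intro k
    have hk := hforce k
    unfold newtonForce at hk
    rw [← Finset.add_sum_erase _ _ (Finset.mem_univ k)]
    rw [sub_self, smul_zero, zero_add]
    conv_lhs => rw [hk]
    refine Finset.sum_congr rfl fun l hl => ?_
    simp only [deltaOfPos]
    have hlk : k ≠ l := fun e => (Finset.ne_of_mem_erase hl) e.symm
    simp only [hlk, if_false]
    congr 1
    rw [div_pow, one_pow]
    field_simp

/-- TRANSFER THEOREM: a finite torus system at `m` forces the set of rescaled mutual-distance
vectors of all positive normalized central configurations at `m` to be finite (any `n`; `κ³ Σ m = 1`,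
e.g. `κ = M^{-1/3}` for positive masses). [cite: JensenLeykin2025, §2.4 p. 3; AlbouyKaloshin2012,
Definition 1 p. 536 — derived in-tree] -/
theorem positiveCC_distanceData_finite_of_jlFinite {n : ℕ} (m : Fin n → ℝ) (κ : ℝ) (hκ0 : κ ≠ 0)
    (hκ : κ ^ 3 * ∑ k, m k = 1) (hfin : (jlNormalizedCCs ℝ m).Finite) :
    ((fun q : Fin n → ℝ × ℝ => jlOfDelta κ (deltaOfPos q)) '' positiveNormalizedCCs m).Finite := by
  refine hfin.subset ?_
  rintro _ ⟨q, hq, rfl⟩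
  exact jlOfDelta_mem_of_isRealNormalizedCC m q (deltaOfPos q)
    (isRealNormalizedCC_of_isPositiveNormalizedCC hq) κ hκ0 hκ

/-- The rescaled distance datum is literally `κ · r_kl` off the diagonal. [folklore] -/
theorem jlOfDelta_deltaOfPos_apply {n : ℕ} (κ : ℝ) (q : Fin n → ℝ × ℝ) (k l : Fin n) (hkl : k ≠ l) :
    jlOfDelta κ (deltaOfPos q) k l = κ * Real.sqrt (sqDist (q k) (q l)) := by
  simp only [jlOfDelta, deltaOfPos, hkl, if_false]
  rw [one_div, div_inv_eq_mul]

/-- For positive masses a valid `κ` always exists (`κ = M^{-1/3}`). [folklore] -/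
theorem exists_kappa_of_sum_pos {n : ℕ} (m : Fin n → ℝ) (hM : 0 < ∑ k, m k) :
    ∃ κ : ℝ, κ ≠ 0 ∧ κ ^ 3 * ∑ k, m k = 1 := by
  refine ⟨((∑ k, m k)⁻¹) ^ ((3 : ℕ)⁻¹ : ℝ), ?_, ?_⟩
  · exact (Real.rpow_pos_of_pos (inv_pos.mpr hM) _).ne'
  · rw [Real.rpow_inv_natCast_pow (inv_pos.mpr hM).le (by norm_num)]
    field_simp

/-- The (unscaled) mutual-distance matrix of a configuration. [folklore] -/
noncomputable def distanceMatrix {n : ℕ} (q : Fin n → ℝ × ℝ) : Fin n → Fin n → ℝ :=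
  fun k l => if k = l then 0 else Real.sqrt (sqDist (q k) (q l))

/-- The dictionary datum is `κ ·` the distance matrix. [folklore] -/
theorem jlOfDelta_deltaOfPos_eq {n : ℕ} (κ : ℝ) (q : Fin n → ℝ × ℝ) :
    jlOfDelta κ (deltaOfPos q) = fun k l => κ * distanceMatrix q k l := by
  funext k l
  by_cases hkl : k = l
  · subst hkl; simp [jlOfDelta, distanceMatrix]
  · simp only [jlOfDelta, deltaOfPos, distanceMatrix, hkl, if_false]
    rw [one_div, div_inv_eq_mul]

/-- TRANSFER, unscaled form: a finite torus system at `m` (with `Σ m > 0`) forces finitely many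
mutual-distance matrices of positive normalized central configurations at `m` — finiteness of the
planar central configurations at `m` up to isometry. [cite: JensenLeykin2025, §2.4 p. 3;
AlbouyKaloshin2012, Definition 1 p. 536 — derived in-tree] -/
theorem positiveCC_distanceMatrix_finite_of_jlFinite {n : ℕ} (m : Fin n → ℝ) (hM : 0 < ∑ k, m k)
    (hfin : (jlNormalizedCCs ℝ m).Finite) :
    (distanceMatrix '' positiveNormalizedCCs m).Finite := by
  obtain ⟨κ, hκ0, hκ⟩ := exists_kappa_of_sum_pos m hM
  have hf := positiveCC_distanceData_finite_of_jlFinite m κ hκ0 hκ hfin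
  have heq : distanceMatrix '' positiveNormalizedCCs m
      = (fun r : Fin n → Fin n → ℝ => fun k l => κ⁻¹ * r k l) ''
          ((fun q : Fin n → ℝ × ℝ => jlOfDelta κ (deltaOfPos q)) '' positiveNormalizedCCs m) := by
    rw [Set.image_image]
    refine Set.image_congr fun q _ => ?_
    rw [jlOfDelta_deltaOfPos_eq]
    funext k l
    field_simp
  rw [heq]
  exact hf.image _

/-- COROLLARY of the named fact of [JensenLeykin2025] (any `n` for which `jlGenericFiniteness n`
holds — the paper proves `n ≤ 5`): GENERIC FINITENESS UP TO ISOMETRY of planar central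
configurations with positive masses — off the real zero set of one nonzero rational polynomial,
every positive mass vector has only finitely many mutual-distance matrices of positive normalized
central configurations. [cite: JensenLeykin2025, §2.4 p. 3 and §4.1 p. 5 — derived in-tree] -/
theorem generic_distanceMatrix_finite_of_jlGenericFiniteness {n : ℕ} (hjl : jlGenericFiniteness n) :
    ∃ P : MvPolynomial (Fin n) ℚ, P ≠ 0 ∧ ∀ m : Fin n → ℝ, 0 < ∑ k, m k →
      MvPolynomial.aeval m P ≠ 0 → (distanceMatrix '' positiveNormalizedCCs m).Finite := by
  obtain ⟨P, hP0, hP⟩ := hjl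
  exact ⟨P, hP0, fun m hM hPm => positiveCC_distanceMatrix_finite_of_jlFinite m hM (hP ℝ m hPm)⟩

/-- The five-body instance, conditional on the named fact `jensenLeykin2025_genericFiniteness_five`
(= `jlGenericFiniteness 5`, the theorem of [JensenLeykin2025] §4.1, used as a hypothesis).
[cite: JensenLeykin2025, §4.1 p. 5 — derived in-tree] -/
theorem fiveBody_generic_distanceMatrix_finite (hjl : jensenLeykin2025_genericFiniteness_five) :
    ∃ P : MvPolynomial (Fin 5) ℚ, P ≠ 0 ∧ ∀ m : Fin 5 → ℝ, 0 < ∑ k, m k →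
      MvPolynomial.aeval m P ≠ 0 → (distanceMatrix '' positiveNormalizedCCs m).Finite :=
  generic_distanceMatrix_finite_of_jlGenericFiniteness hjl

end Literature.Dynamics.NBody
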